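import Summits.Ventures.PercRepro.C025ProfileGirthHallPaving

/-!
# C-025, EVERY ROW OF (Π) AND THE HALL FORM (C-033) ON EVERY UNIFORM MATROID (night-3 g21)

A finite matroid is UNIFORM of rank `k` when its independent sets are exactly the subsets of the ground set with at
most `k` elements (`hM : ∀ I, M.Indep I ↔ I ⊆ M.E ∧ I.encard ≤ k`; no construction is needed — the characterisation
is the hypothesis).  Such a matroid is paving: its rank is at most `k` (`eRank_le_of_indep_iff`) and every circuit
has more than `k` elements (`paving_of_indep_iff`), so the paving theorems of the companion modules apply:
* **`rls_of_uniform (hM) (p q) : ThmN.RLS M p q`** — C-025 at every `(p, q)`;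
* **`profileIneq_of_uniform (hM) (q u) (1 ≤ q) (q < u) : Profile.ProfileIneq M q u`** — every row of (Π);
* **`hallIneq_of_uniform (hM) (q u) (q < u) : Profile.HallIneq M q u`** — the Hall form (C-033) of every row.
No `def`, no `instance`, no notation.  Axioms: standard.
-/

open scoped Matroid

namespace PercRepro

open Set Finset

namespace PavingRows

variable {α : Type} [DecidableEq α] {M : Matroid α} [M.Finite]

omit [DecidableEq α] [M.Finite] in
/-- A matroid whose independent sets are the sets of at most `k` points has rank at most `k`. -/
theorem eRank_le_of_indep_iff {k : ℕ} (hM : ∀ I, M.Indep I ↔ I ⊆ M.E ∧ I.encard ≤ k) : M.eRank ≤ k := by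
  obtain ⟨B, hB⟩ := M.exists_isBase
  rw [← hB.encard_eq_eRank]
  exact ((hM B).1 hB.indep).2

omit [DecidableEq α] [M.Finite] in
/-- A matroid whose independent sets are the sets of at most `k` points is paving: every circuit has more than `k`
points, and the rank is at most `k`. -/
theorem paving_of_indep_iff {k : ℕ} (hM : ∀ I, M.Indep I ↔ I ⊆ M.E ∧ I.encard ≤ k) :
    ∀ C, M.IsCircuit C → M.eRank ≤ C.encard := by
  intro C hC
  have h1 : ¬ (C ⊆ M.E ∧ C.encard ≤ k) := fun h => hC.not_indep ((hM C).2 h)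
  have h2 : ¬ C.encard ≤ (k : ℕ∞) := fun h => h1 ⟨hC.subset_ground, h⟩
  exact (eRank_le_of_indep_iff hM).trans (not_le.1 h2).le

/-- **C-025 at every `(p, q)` on every uniform matroid** (independent sets = sets of at most `k` points). -/
theorem rls_of_uniform {k : ℕ} (hM : ∀ I, M.Indep I ↔ I ⊆ M.E ∧ I.encard ≤ k) (p q : ℕ) : ThmN.RLS M p q :=
  rls_of_paving (paving_of_indep_iff hM) p q

/-- **Every row `(q, u)` of (Π), `1 ≤ q < u`, on every uniform matroid.** -/
theorem profileIneq_of_uniform {k : ℕ} (hM : ∀ I, M.Indep I ↔ I ⊆ M.E ∧ I.encard ≤ k) (q u : ℕ) (hq : 1 ≤ q)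
    (hqu : q < u) : Profile.ProfileIneq M q u :=
  profileIneq_of_paving (paving_of_indep_iff hM) q u hq hqu

/-- **The Hall form (C-033) of every row `(q, u)`, `q < u`, on every uniform matroid.** -/
theorem hallIneq_of_uniform {k : ℕ} (hM : ∀ I, M.Indep I ↔ I ⊆ M.E ∧ I.encard ≤ k) (q u : ℕ) (hqu : q < u) :
    Profile.HallIneq M q u :=
  hallIneq_of_paving (paving_of_indep_iff hM) q u hqu

end PavingRows

end PercRepro
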